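import Summits.ValiantsHypothesis.ValiantsHypothesis.Theorems.GrenetZeonDualUnipotentThreeHalvesHeavyTopHalfSpeedSeam

/-!
# `GrenetZeon.DualUnipotentThreeHalves` (stmt-ValiantsHypothesis-24318), LINE β `half_speed`, K1 remainder (i) (val-port-3 g2's pool list
# 19:39:40Z): THE REINDEX BRIDGE — a block-upper matrix along a predicate `p` becomes `fromBlocks A B 0 D` on `{p} ⊕ {¬p}`

Pool hand val-port-2 g2 (α lead; β K0 ✓ p661921).  K1 `stub_halfSpeedLaw_of_irr` peels a composition chain one level at a time; each
peel needs the space `U ≤ M_ι(ℂ)`, block-upper along «`p` = the upper levels» (entries with row outside `p` and column inside `p` vanish),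
presented on `{i // p i} ⊕ {i // ¬ p i}` with `toBlocks₂₁ = 0` — the input shape of ✓ port-3 g2's `exists_halfSpeed_seam` (p661793) —
and transported back by ✓ `halfSpeed_reindex` (p661099).  This file supplies exactly that bridge, for an arbitrary decidable predicate.

* `splitEquiv p : ι ≃ {i // p i} ⊕ {i // ¬ p i}` (= `(Equiv.sumCompl p).symm`) and the four entry formulas of `reindex (splitEquiv p)`.
* `toBlocks₂₁_reindex_split` — block-upper along `p` ⇒ `toBlocks₂₁ = 0`; `toBlocks₁₁/₂₂_reindex_split` = the `p`/`¬p` diagonal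
  submatrices; ★ `reindex_split_eq_fromBlocks` — the `fromBlocks A B 0 D` form.
* Submodule packaging: `splitMap p U := U.map (reindex)`; `toBlocks₂₁_eq_zero_of_mem_splitMap`, `finrank_splitMap`,
  `halfSpeed_splitMap_iff` (HalfSpeed is transported both ways), `mem_splitMap_iff`.

Honest framing.  Index bookkeeping (`--supports stmt-ValiantsHypothesis-24318 --as helper`); proves nothing about `HalfSpeedLaw`,
`HalfSpeedIrrLaw`, R2, the crux, 8062 or `VP ≠ VNP` — all OPEN / NOT proved. [β food table 19:21:32Z; port-3 pool list (i)]
-/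

set_option linter.dupNamespace false
set_option autoImplicit false

noncomputable section

namespace Summit.ValiantsHypothesis.ValiantsHypothesis.Theorems.GrenetZeon.HalfSpeed

open Matrix

variable {ι : Type*}

/-! ## §1 The split reindexing -/

/-- The two-block reindexing along a decidable predicate: `p`-indices first, then the others. -/
def splitEquiv (p : ι → Prop) [DecidablePred p] : ι ≃ {i // p i} ⊕ {i // ¬ p i} :=
  (Equiv.sumCompl p).symm

/-- Entry formula, block `(1,1)`. -/
@[simp] theorem reindex_split_inl_inl (p : ι → Prop) [DecidablePred p] (A : Matrix ι ι ℂ)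
    (i j : {i // p i}) : Matrix.reindex (splitEquiv p) (splitEquiv p) A (Sum.inl i) (Sum.inl j) = A i j := by
  simp [splitEquiv, Matrix.reindex_apply]

/-- Entry formula, block `(1,2)`. -/
@[simp] theorem reindex_split_inl_inr (p : ι → Prop) [DecidablePred p] (A : Matrix ι ι ℂ)
    (i : {i // p i}) (j : {i // ¬ p i}) :
    Matrix.reindex (splitEquiv p) (splitEquiv p) A (Sum.inl i) (Sum.inr j) = A i j := by
  simp [splitEquiv, Matrix.reindex_apply]

/-- Entry formula, block `(2,1)`. -/
@[simp] theorem reindex_split_inr_inl (p : ι → Prop) [DecidablePred p] (A : Matrix ι ι ℂ)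
    (i : {i // ¬ p i}) (j : {i // p i}) :
    Matrix.reindex (splitEquiv p) (splitEquiv p) A (Sum.inr i) (Sum.inl j) = A i j := by
  simp [splitEquiv, Matrix.reindex_apply]

/-- Entry formula, block `(2,2)`. -/
@[simp] theorem reindex_split_inr_inr (p : ι → Prop) [DecidablePred p] (A : Matrix ι ι ℂ)
    (i j : {i // ¬ p i}) : Matrix.reindex (splitEquiv p) (splitEquiv p) A (Sum.inr i) (Sum.inr j) = A i j := by
  simp [splitEquiv, Matrix.reindex_apply]

/-! ## §2 Block-upper along `p` ⇒ `fromBlocks A B 0 D` -/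

/-- **Block-upper along `p` kills the `(2,1)` block**: if `A i j = 0` whenever `¬ p i` and `p j`, then the reindexed matrix has
`toBlocks₂₁ = 0` — the hypothesis `hblock` of ✓ `exists_halfSpeed_seam`. -/
theorem toBlocks₂₁_reindex_split (p : ι → Prop) [DecidablePred p] (A : Matrix ι ι ℂ)
    (h : ∀ i j, ¬ p i → p j → A i j = 0) :
    (Matrix.reindex (splitEquiv p) (splitEquiv p) A).toBlocks₂₁ = 0 := by
  ext i j
  rw [Matrix.toBlocks₂₁, Matrix.of_apply, reindex_split_inr_inl, Matrix.zero_apply]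
  exact h i j i.2 j.2

/-- The `(1,1)` block is the `p`-diagonal submatrix. -/
theorem toBlocks₁₁_reindex_split (p : ι → Prop) [DecidablePred p] (A : Matrix ι ι ℂ) :
    (Matrix.reindex (splitEquiv p) (splitEquiv p) A).toBlocks₁₁ =
      A.submatrix (Subtype.val : {i // p i} → ι) (Subtype.val : {i // p i} → ι) := by
  ext i j
  rw [Matrix.toBlocks₁₁, Matrix.of_apply, reindex_split_inl_inl, Matrix.submatrix_apply]

/-- The `(2,2)` block is the `¬p`-diagonal submatrix. -/
theorem toBlocks₂₂_reindex_split (p : ι → Prop) [DecidablePred p] (A : Matrix ι ι ℂ) :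
    (Matrix.reindex (splitEquiv p) (splitEquiv p) A).toBlocks₂₂ =
      A.submatrix (Subtype.val : {i // ¬ p i} → ι) (Subtype.val : {i // ¬ p i} → ι) := by
  ext i j
  rw [Matrix.toBlocks₂₂, Matrix.of_apply, reindex_split_inr_inr, Matrix.submatrix_apply]

/-- The `(1,2)` block is the `p × ¬p` submatrix. -/
theorem toBlocks₁₂_reindex_split (p : ι → Prop) [DecidablePred p] (A : Matrix ι ι ℂ) :
    (Matrix.reindex (splitEquiv p) (splitEquiv p) A).toBlocks₁₂ =
      A.submatrix (Subtype.val : {i // p i} → ι) (Subtype.val : {i // ¬ p i} → ι) := by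
  ext i j
  rw [Matrix.toBlocks₁₂, Matrix.of_apply, reindex_split_inl_inr, Matrix.submatrix_apply]

/-- ★ **THE `fromBlocks` FORM**: a matrix block-upper along `p` is, after the split reindexing,
`fromBlocks (A|_{p×p}) (A|_{p×¬p}) 0 (A|_{¬p×¬p})`. [this file] -/
theorem reindex_split_eq_fromBlocks (p : ι → Prop) [DecidablePred p] (A : Matrix ι ι ℂ)
    (h : ∀ i j, ¬ p i → p j → A i j = 0) :
    Matrix.reindex (splitEquiv p) (splitEquiv p) A =
      Matrix.fromBlocks (A.submatrix (Subtype.val : {i // p i} → ι) Subtype.val)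
        (A.submatrix (Subtype.val : {i // p i} → ι) (Subtype.val : {i // ¬ p i} → ι)) 0
        (A.submatrix (Subtype.val : {i // ¬ p i} → ι) Subtype.val) := by
  rw [← Matrix.fromBlocks_toBlocks (Matrix.reindex (splitEquiv p) (splitEquiv p) A), toBlocks₁₁_reindex_split,
    toBlocks₁₂_reindex_split, toBlocks₂₁_reindex_split p A h, toBlocks₂₂_reindex_split]

/-! ## §3 Submodule packaging and transport of `HalfSpeed` -/

section Spaces

/-- The reindexed copy of a space of matrices. -/
def splitMap (p : ι → Prop) [DecidablePred p] (U : Submodule ℂ (Matrix ι ι ℂ)) :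
    Submodule ℂ (Matrix ({i // p i} ⊕ {i // ¬ p i}) ({i // p i} ⊕ {i // ¬ p i}) ℂ) :=
  U.map (Matrix.reindexLinearEquiv ℂ ℂ (splitEquiv p) (splitEquiv p)).toLinearMap

/-- Membership in the reindexed copy. -/
theorem mem_splitMap_iff (p : ι → Prop) [DecidablePred p] (U : Submodule ℂ (Matrix ι ι ℂ))
    (A' : Matrix ({i // p i} ⊕ {i // ¬ p i}) ({i // p i} ⊕ {i // ¬ p i}) ℂ) :
    A' ∈ splitMap p U ↔ ∃ A ∈ U, Matrix.reindex (splitEquiv p) (splitEquiv p) A = A' := by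
  rw [splitMap, Submodule.mem_map]
  constructor
  · rintro ⟨A, hA, rfl⟩; exact ⟨A, hA, rfl⟩
  · rintro ⟨A, hA, rfl⟩; exact ⟨A, hA, rfl⟩

/-- As sets, the reindexed copy is the image under `reindex`. -/
theorem coe_splitMap (p : ι → Prop) [DecidablePred p] (U : Submodule ℂ (Matrix ι ι ℂ)) :
    (splitMap p U : Set (Matrix ({i // p i} ⊕ {i // ¬ p i}) ({i // p i} ⊕ {i // ¬ p i}) ℂ)) =
      (Matrix.reindex (splitEquiv p) (splitEquiv p)) '' (U : Set (Matrix ι ι ℂ)) := by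
  ext A'
  rw [SetLike.mem_coe, mem_splitMap_iff, Set.mem_image]
  simp only [SetLike.mem_coe]

/-- The reindexed copy has the same dimension. -/
theorem finrank_splitMap (p : ι → Prop) [DecidablePred p] (U : Submodule ℂ (Matrix ι ι ℂ)) :
    Module.finrank ℂ (splitMap p U) = Module.finrank ℂ U :=
  LinearEquiv.finrank_map_eq _ _

/-- Monotonicity of the reindexed copy. -/
theorem splitMap_mono (p : ι → Prop) [DecidablePred p] {T U : Submodule ℂ (Matrix ι ι ℂ)} (h : T ≤ U) :
    splitMap p T ≤ splitMap p U :=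
  Submodule.map_mono h

/-- Block-upper spaces along `p` have `toBlocks₂₁ = 0` on the reindexed copy (the `hblock` input of ✓ `exists_halfSpeed_seam`). -/
theorem toBlocks₂₁_eq_zero_of_mem_splitMap (p : ι → Prop) [DecidablePred p] (U : Submodule ℂ (Matrix ι ι ℂ))
    (hU : ∀ A ∈ U, ∀ i j, ¬ p i → p j → A i j = 0)
    (A' : Matrix ({i // p i} ⊕ {i // ¬ p i}) ({i // p i} ⊕ {i // ¬ p i}) ℂ) (hA' : A' ∈ splitMap p U) :
    A'.toBlocks₂₁ = 0 := by
  obtain ⟨A, hA, rfl⟩ := (mem_splitMap_iff p U A').1 hA'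
  exact toBlocks₂₁_reindex_split p A (hU A hA)

variable [Fintype ι] [DecidableEq ι]

/-- **`HalfSpeed` transports to the reindexed copies** (✓ `halfSpeed_reindex`). -/
theorem halfSpeed_splitMap (p : ι → Prop) [DecidablePred p] (Θ : ℕ) (U T : Submodule ℂ (Matrix ι ι ℂ))
    (h : HalfSpeed Θ (U : Set (Matrix ι ι ℂ)) T) :
    HalfSpeed Θ (splitMap p U : Set (Matrix ({i // p i} ⊕ {i // ¬ p i}) ({i // p i} ⊕ {i // ¬ p i}) ℂ))
      (splitMap p T) := by
  rw [coe_splitMap, coe_splitMap]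
  exact halfSpeed_reindex (splitEquiv p) Θ _ _ h

/-- **… and back**: `HalfSpeed` on the reindexed copies gives `HalfSpeed` on the originals (reindex by the inverse). -/
theorem halfSpeed_of_splitMap (p : ι → Prop) [DecidablePred p] (Θ : ℕ) (U T : Submodule ℂ (Matrix ι ι ℂ))
    (h : HalfSpeed Θ (splitMap p U : Set (Matrix ({i // p i} ⊕ {i // ¬ p i}) ({i // p i} ⊕ {i // ¬ p i}) ℂ))
      (splitMap p T)) :
    HalfSpeed Θ (U : Set (Matrix ι ι ℂ)) T := by
  have h' := halfSpeed_reindex (splitEquiv p).symm Θ _ _ h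
  rw [coe_splitMap, coe_splitMap, ← Set.image_comp, ← Set.image_comp] at h'
  have hid : (⇑(Matrix.reindex (α := ℂ) (splitEquiv p).symm (splitEquiv p).symm) ∘
      ⇑(Matrix.reindex (α := ℂ) (splitEquiv p) (splitEquiv p))) = id := by
    funext A; simp
  simpa [hid] using h'

end Spaces

end Summit.ValiantsHypothesis.ValiantsHypothesis.Theorems.GrenetZeon.HalfSpeed

end
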